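import Summits.KontsevichZagierPeriods.KontsevichZagierPeriods.Theorems.CubeKernelStep.Negative.StepRule2
import Summits.KontsevichZagierPeriods.KontsevichZagierPeriods.Theorems.LogPrimitiveNL.Negative.Defs
import Literature.NumberTheory.Transcendental.KZFibredRelations

/-!
# `CubeKernelStep` (stmt-KontsevichZagierPeriods-17854) — negative side V: the step is not fibred over the parameter

cdisprove (refuter) negative lemma for the crux `CubeKernelStep` of route
`KontsevichZagierPeriods/UnfoldedStokes`, sharpening `cubeKernelStep_false_without_changeOfVariables`
(`Negative/StepRule2.lean`):

  **`cubeKernelStep_false_fibred`** — the statement of the crux with `KZ.relations` replaced by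
  `KZ.fibredRelations ⊔ closure {[r] : dim r ≤ 1}` is FALSE at `d = 1`.

`KZ.fibredRelations` (tree, `KZFibredRelations.lean`) is the subgroup generated by ALL instances of
the additivity rules (1a), (1b), the FIBRED changes of variables (rule (2) with `Φ x 0 = x 0`: the
substitution preserves the parameter coordinate, in every dimension) and the Newton–Leibniz moves over
bases of positive dimension — Ayoub's "rules relative to a base" read on total spaces. So: granting
every relation among representations of dimension `≤ 1` AND every chain of moves fibred over the
parameter axis `s = z 0`, the continuous square kernel element `sqRep` (value `0`) is still not
generated (`sqRep_not_mem_fibred`). ANY PROOF OF THE STEP `1 → 2` CONTAINS A MOVE THAT MOVES THE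
PARAMETER (`Φ x 0 ≠ x 0`; for `sqRep` a coordinate transposition does it). "Integrating the parameter
out" — the passage `K₁(d) ⟹ K₀(d+1)` of the relative-injectivity card, or the base change of
`MeanRealisation` — is not a fibred operation, and it is exactly where the crux lives.

Mechanism: slices of fibred relations vanish for a.e. parameter (tree: `KZ.sliceEval_ae_eq_zero`,
slab restriction + soundness + Fubini); slices of low-dimensional generators are `ℚ`-semialgebraic
functions of the parameter (extension by zero of a one-variable integrand); the slice function of
`sqRep` is its period function `V(s) = log ((2−s)/(1+s))`, which agrees with no `ℚ`-semialgebraic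
function a.e. on `(0,1)` (a.e. ⇒ off a finite set by the monotonicity theorem and continuity; then
the simple-pole descent of `StepRule2.lean`). Also: `rulesOneThreeLow ≤ fibredRelations ⊔ closure lowDim`
(`rulesOneThreeLow_le_fibred`), so this file's theorem implies the one of `StepRule2.lean`.

[Kontsevich–Zagier 2001, §1.2; Ayoub 2015, §1 and Rem. 1.2, 1.5; van den Dries 1998, Ch. 3 (1.2)]
-/

noncomputable section

namespace Summit.KontsevichZagierPeriods.UnfoldedStokes.CubeKernelStepNegative

open MeasureTheory Set Filter Topology
open Literature.NumberTheory.Transcendental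
open Literature.NumberTheory.Transcendental.KZ
open Literature.ModelTheory.ExponentialFields (IsSemialgebraic)
open Summit.KontsevichZagierPeriods.CompleteModGammaSectorNegative (fin_one_eq)
open Literature.Barriers.KontsevichZagierPeriods.KZ (NoSemialgPrimKernel.eq_zero_of_evalEval_eq_zero)
open Summit.KontsevichZagierPeriods.HermiteRigidity.EllipticMomentKernelNegative (snoc₂_apply_zero snoc₂_apply_one)

/-! ### Slices of low-dimensional generators are semialgebraic in the parameter -/

/-- `vecCons s` of the empty tuple is the constant tuple `s` of `ℝ¹`. [folklore] -/
theorem vecCons_fin_zero (s : ℝ) (x : Fin 0 → ℝ) : (Matrix.vecCons s x : Fin 1 → ℝ) = fun _ => s := by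
  rw [fin_one_eq (Matrix.vecCons s x)]
  rfl

/-- **The slice function of a one-dimensional representation is its integrand extended by zero**
(the fibre over `s` is the point `ℝ⁰`, of volume `1`, present iff `s ∈ τ`). [folklore] -/
theorem sliceValue_eq_baseFun (r : IntegralRep 1) : sliceValue r = baseFun r := by
  funext s
  rw [sliceValue_def]
  by_cases hs : (fun _ : Fin 1 => s) ∈ r.domain
  · have hset : {x : Fin 0 → ℝ | Matrix.vecCons s x ∈ r.domain} = univ :=
      eq_univ_of_forall fun x => by rw [mem_setOf_eq, vecCons_fin_zero]; exact hs
    rw [hset, baseFun, indicator_of_mem (show s ∈ baseLine r from hs),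
      Summit.KontsevichZagierPeriods.LiouvilleUnfolding.LogPrimitiveNL.Negative.setIntegral_univ_fin_zero,
      vecCons_fin_zero]
  · have hset : {x : Fin 0 → ℝ | Matrix.vecCons s x ∈ r.domain} = ∅ :=
      eq_empty_of_forall_notMem fun x hx => hs (by rw [mem_setOf_eq, vecCons_fin_zero] at hx; exact hx)
    rw [hset, Measure.restrict_empty, integral_zero_measure, baseFun,
      indicator_of_notMem (show s ∉ baseLine r from hs)]

/-- **Slices along the low-dimensional sub-calculus are semialgebraic**: for `b` in the subgroup
generated by all representations of dimension `≤ 1`, `sliceEval b` IS (everywhere) a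
`ℚ`-semialgebraic function of the parameter. [cite: BochnakCosteRoy1998, Def. 2.2.5] -/
theorem exists_semialgebraic_sliceEval_of_mem_closure_lowDim {b : FormalRep}
    (hb : b ∈ AddSubgroup.closure lowDim) :
    ∃ g : ℝ → ℝ, IsSemialgebraicFunOn ℚ (univ : Set (Fin 1 → ℝ)) (fun z => g (z 0)) ∧ sliceEval b = g := by
  refine AddSubgroup.closure_induction (p := fun x _ =>
      ∃ g : ℝ → ℝ, IsSemialgebraicFunOn ℚ (univ : Set (Fin 1 → ℝ)) (fun z => g (z 0)) ∧ sliceEval x = g)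
    (fun x hx => ?_) ?_ (fun x y _ _ hx hy => ?_) (fun x _ hx => ?_) hb
  · obtain ⟨n, r, hn, rfl⟩ := hx
    match n, r, hn with
    | 0, r, _ =>
      exact ⟨fun _ => 0, (isSemialgebraicFunOn_natCast
        Literature.ModelTheory.ExponentialFields.isSemialgebraic_univ 0).congr fun _ _ => by simp,
        by rw [sliceEval_of_zero]; rfl⟩
    | 1, r, _ => exact ⟨baseFun r, baseFun_isSemialgebraicFunOn r, by rw [sliceEval_of, sliceValue_eq_baseFun]⟩
    | n + 2, _, hn => omega
  · exact ⟨fun _ => 0, (isSemialgebraicFunOn_natCast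
      Literature.ModelTheory.ExponentialFields.isSemialgebraic_univ 0).congr fun _ _ => by simp,
      by rw [map_zero]; rfl⟩
  · obtain ⟨g, hg, hxg⟩ := hx
    obtain ⟨g', hg', hyg⟩ := hy
    exact ⟨fun s => g s + g' s, IsSemialgebraicFunOn.add_holds hg hg', by rw [map_add, hxg, hyg]; rfl⟩
  · obtain ⟨g, hg, hxg⟩ := hx
    exact ⟨fun s => -g s, hg.neg, by rw [map_neg, hxg]; rfl⟩

/-! ### The slice function of the witness is its period function -/

/-- On `[0,1]` the slice of the square over `s` is the unit interval. [folklore] -/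
theorem sliceSet_sqRep {s : ℝ} (hs : s ∈ Icc (0:ℝ) 1) :
    {x : Fin 1 → ℝ | Matrix.vecCons s x ∈ sqRep.domain} = cube 1 := by
  have hd : sqRep.domain = cube 2 := rfl
  ext x
  simp only [hd, mem_setOf_eq, mem_cube, Fin.forall_fin_two, Fin.forall_fin_one, Matrix.cons_val_zero,
    Matrix.cons_val_one]
  exact ⟨fun h => h.2, fun h => ⟨⟨hs.1, hs.2⟩, h⟩⟩

/-- The square integrand on the slice, read through `Fin.snoc`. [folklore] -/
theorem sqFun_vecCons (s : ℝ) (x : Fin 1 → ℝ) :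
    sqFun (Matrix.vecCons s x) = sqFun (Fin.snoc (fun _ : Fin 1 => s) (x 0)) := by
  simp only [sqFun, snoc₂_apply_zero, snoc₂_apply_one, Matrix.cons_val_zero, Matrix.cons_val_one]

/-- **The slice function of the witness is its period function** on `[0,1]`:
`sliceValue sqRep s = ∫₀¹ h(s,x) dx = V(s)` (Newton–Leibniz in `x` with the transcendental primitive
`H(s,·)`). [folklore] -/
theorem sliceValue_sqRep {s : ℝ} (hs : s ∈ Icc (0:ℝ) 1) : sliceValue sqRep s = periodFun s := by
  rw [sliceValue_def, sliceSet_sqRep hs]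
  set E := MeasurableEquiv.funUnique (Fin 1) ℝ with hE
  have hE_apply : ∀ z : Fin 1 → ℝ, E z = z 0 := fun z => rfl
  have hmp : MeasurePreserving E volume volume := volume_preserving_funUnique (Fin 1) ℝ
  have hset : cube 1 = E ⁻¹' Icc (0:ℝ) 1 := by
    ext x
    simp only [mem_cube, Fin.forall_fin_one, mem_preimage, hE_apply, mem_Icc]
  set F : ℝ → ℝ := fun u => sqPrim (Fin.snoc (fun _ : Fin 1 => s) u) with hF
  set f : ℝ → ℝ := fun u => sqFun (Fin.snoc (fun _ : Fin 1 => s) u) with hf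
  have hderiv : ∀ t ∈ Icc (0:ℝ) 1, HasDerivAt F (f t) t := fun t ht =>
    hasDerivAt_sqPrim (y := fun _ => s) hs ht
  have hcont : ContinuousOn F (Icc 0 1) := fun t ht => (hderiv t ht).continuousAt.continuousWithinAt
  have hfcont : ContinuousOn f (Icc 0 1) := by
    have hf' : f = fun u => 1 / (1 + u) - s / (2 - s * u) - s / (1 + s * u) := by
      funext u
      show sqFun (Fin.snoc (fun _ : Fin 1 => s) u) = _
      simp only [sqFun, snoc₂_apply_zero, snoc₂_apply_one]
    rw [hf']
    refine ContinuousOn.sub (ContinuousOn.sub ?_ ?_) ?_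
    · exact continuousOn_const.div (continuousOn_const.add continuousOn_id)
        fun u hu => (denom_pos hs hu).1.ne'
    · exact continuousOn_const.div (continuousOn_const.sub (continuousOn_const.mul continuousOn_id))
        fun u hu => (denom_pos hs hu).2.1.ne'
    · exact continuousOn_const.div (continuousOn_const.add (continuousOn_const.mul continuousOn_id))
        fun u hu => (denom_pos hs hu).2.2.ne'
  calc ∫ x in cube 1, sqRep.integrand (Matrix.vecCons s x)
      = ∫ x in E ⁻¹' Icc (0:ℝ) 1, f (E x) := by
        rw [hset]
        refine setIntegral_congr_fun (measurableSet_Icc.preimage E.measurable) fun x _ => ?_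
        exact sqFun_vecCons s x
    _ = ∫ t in Icc (0:ℝ) 1, f t := hmp.setIntegral_preimage_emb E.measurableEmbedding f (Icc 0 1)
    _ = F 1 - F 0 := by
        rw [integral_Icc_eq_integral_Ioc, ← intervalIntegral.integral_of_le zero_le_one]
        exact intervalIntegral.integral_eq_sub_of_hasDerivAt_of_le zero_le_one hcont
          (fun t ht => hderiv t (Ioo_subset_Icc_self ht)) (hfcont.intervalIntegrable_of_Icc zero_le_one)
    _ = periodFun s := by
        simp only [hF, sqPrim, periodFun, snoc₂_apply_zero, snoc₂_apply_one, mul_one, mul_zero, add_zero, sub_zero,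
          Real.log_one]
        norm_num
        ring

/-! ### The period function agrees with no semialgebraic function off a finite set -/

open Polynomial in
open scoped Polynomial.Bivariate in
/-- **No `ℚ`-semialgebraic function of one variable agrees with the period function
`V = log ((2−s)/(1+s))` off a finite subset of `(0,1)`** (polynomial identity off the finite set,
everywhere by continuity, impossible by the simple-pole descent `((s−2)(s+1))V′ = 3`).
[cite: Ayoub2015, Rem. 1.2] [cite: Fresan2024, Rem. 3.6] -/
theorem periodFun_ne_semialgebraic_off_finset (s₀ : Finset ℝ) {g : ℝ → ℝ}
    (hg : IsSemialgebraicFunOn ℚ openWindow (fun z => g (z 0)))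
    (hgV : ∀ e ∈ Ioo (0:ℝ) 1, e ∉ s₀ → g e = periodFun e) : False := by
  obtain ⟨P, hP0, hPg⟩ := exists_ne_zero_evalEval_eq_zero_Ioo hg
  have hcont : ContinuousOn (fun t => P.evalEval t (periodFun t)) (Ioo 0 1) :=
    continuousOn_evalEval P (continuousOn_periodFun.mono Ioo_subset_Icc_self)
  have hPV : ∀ t ∈ Ioo (0:ℝ) 1, P.evalEval t (periodFun t) = 0 := by
    intro t ht
    by_contra hne
    have hct : ContinuousAt (fun t => P.evalEval t (periodFun t)) t :=
      hcont.continuousAt (Ioo_mem_nhds ht.1 ht.2)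
    have hev : ∀ᶠ u in 𝓝 t, P.evalEval u (periodFun u) ≠ 0 ∧ u ∈ Ioo (0:ℝ) 1 :=
      (hct.eventually_ne hne).and (Ioo_mem_nhds ht.1 ht.2)
    obtain ⟨ε, hε, hball⟩ := Metric.eventually_nhds_iff.mp hev
    have hinf : (Ioo (t - ε / 2) (t + ε / 2)).Infinite := Ioo_infinite (by linarith)
    obtain ⟨u, hu, hus⟩ := hinf.exists_notMem_finset s₀
    have hdist : dist u t < ε := by
      rw [Real.dist_eq, abs_lt]
      constructor <;> linarith [hu.1, hu.2]
    obtain ⟨hne', hu01⟩ := hball hdist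
    exact hne' (by rw [← hgV u hu01 hus]; exact hPg u hu01)
  have hV1 : (X + C (1:ℝ) : ℝ[X]).eval 2 ≠ 0 := by norm_num
  have hN : (C (3:ℝ) : ℝ[X]).eval 2 ≠ 0 := by norm_num
  have hDN : ∀ t ∈ Ioo (0:ℝ) 1,
      ((X - C (2:ℝ)) * (X + C 1) : ℝ[X]).eval t * ((-1) / (2 - t) - 1 / (1 + t)) = (C (3:ℝ) : ℝ[X]).eval t := by
    intro t ht
    have h2 : (2:ℝ) - t ≠ 0 := by linarith [ht.2]
    have h1 : (1:ℝ) + t ≠ 0 := by linarith [ht.1]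
    rw [Polynomial.eval_mul, Polynomial.eval_sub, Polynomial.eval_add, Polynomial.eval_X, Polynomial.eval_C,
      Polynomial.eval_C, Polynomial.eval_C]
    field_simp
    ring
  exact hP0 (NoSemialgPrimKernel.eq_zero_of_evalEval_eq_zero (fun t ht => hasDerivAt_periodFun ht)
    hDN hV1 hN P.natDegree P le_rfl hPV)

/-- Two functions continuous at a point and a.e. equal near it agree at the point. [folklore] -/
theorem eq_of_continuousAt_of_ae {V g : ℝ → ℝ} {e : ℝ} (hV : ContinuousAt V e) (hg : ContinuousAt g e)
    (hae : ∀ᵐ s ∂(volume : Measure ℝ), s ∈ Ioo (0:ℝ) 1 → V s = g s) (he : e ∈ Ioo (0:ℝ) 1) :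
    V e = g e := by
  by_contra hne
  have hev : ∀ᶠ u in 𝓝 e, V u - g u ≠ 0 ∧ u ∈ Ioo (0:ℝ) 1 :=
    ((hV.sub hg).eventually_ne (sub_ne_zero.mpr hne)).and (Ioo_mem_nhds he.1 he.2)
  obtain ⟨ε, hε, hball⟩ := Metric.eventually_nhds_iff.mp hev
  have hsub : Metric.ball e ε ⊆ {s | ¬ (s ∈ Ioo (0:ℝ) 1 → V s = g s)} := fun u hu => by
    obtain ⟨hne', hu01⟩ := hball (Metric.mem_ball.mp hu)
    show ¬ (u ∈ Ioo (0:ℝ) 1 → V u = g u)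
    exact fun h => hne' (sub_eq_zero.mpr (h hu01))
  have h0 : volume (Metric.ball e ε) = 0 := measure_mono_null hsub (ae_iff.mp hae)
  exact (Metric.measure_ball_pos volume e hε).ne' h0

/-! ### The witness is not fibred-reachable -/

/-- Representations of dimension `≤ 1` lie in the enlarged fibred sub-calculus. [folklore] -/
theorem of_mem_fibred_sup_of_le_one {n : ℕ} (hn : n ≤ 1) (r : IntegralRep n) :
    of r ∈ fibredRelations ⊔ AddSubgroup.closure lowDim :=
  AddSubgroup.mem_sup_right (AddSubgroup.subset_closure ⟨n, r, hn, rfl⟩)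

/-- **THE SEPARATION.** `[sqRep] ∉ fibredRelations ⊔ closure lowDim`: the slice function of a
fibred relation vanishes a.e. (`KZ.sliceEval_ae_eq_zero`), that of a low-dimensional combination is
`ℚ`-semialgebraic, and that of `sqRep` is the period function `V`, which is a.e. equal to no
semialgebraic function on `(0,1)`. [cite: Ayoub2015, §1] [cite: KontsevichZagier2001, §1.2] -/
theorem sqRep_not_mem_fibred : of sqRep ∉ fibredRelations ⊔ AddSubgroup.closure lowDim := by
  intro hmem
  obtain ⟨a, ha, b, hb, hab⟩ := AddSubgroup.mem_sup.mp hmem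
  obtain ⟨g, hg, hbg⟩ := exists_semialgebraic_sliceEval_of_mem_closure_lowDim hb
  -- slices: sliceValue sqRep = sliceEval a + g, and sliceEval a = 0 a.e.
  have hslice : sliceValue sqRep = sliceEval a + g := by
    rw [← sliceEval_of, ← hab, map_add, hbg]
  have hae0 : sliceEval a =ᵐ[volume] 0 := sliceEval_ae_eq_zero ha
  have hae : ∀ᵐ s ∂(volume : Measure ℝ), s ∈ Ioo (0:ℝ) 1 → periodFun s = g s := by
    filter_upwards [hae0] with s hs hs01
    have h := congrFun hslice s
    rw [Pi.add_apply, hs, Pi.zero_apply, zero_add, sliceValue_sqRep (Ioo_subset_Icc_self hs01)] at h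
    exact h
  -- `g` is continuous off a finite subset of (−1, 2)
  have hgIoo : IsSemialgebraicFunOn ℚ {t : Fin 1 → ℝ | t 0 ∈ Ioo (((-1:ℚ):ℝ)) (2:ℚ)} (fun z => g (z 0)) :=
    hg.mono (subset_univ _) (BallPeeling.isSemialgebraic_Ioo₁ (-1) 2)
  obtain ⟨s₀, hs₀⟩ := exists_finset_continuousAt (a := ((-1:ℚ):ℝ)) (b := ((2:ℚ):ℝ)) (by norm_num) hgIoo
  -- hence `g = V` off `s₀` on (0,1)
  have hgV : ∀ e ∈ Ioo (0:ℝ) 1, e ∉ s₀ → g e = periodFun e := fun e he hes =>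
    (eq_of_continuousAt_of_ae (hasDerivAt_periodFun he).continuousAt
      (hs₀ e ⟨by have := he.1; push_cast; linarith, by have := he.2; push_cast; linarith⟩ hes) hae he).symm
  exact periodFun_ne_semialgebraic_off_finset s₀ (hg.mono (subset_univ _) isSemialgebraic_openWindow) hgV

/-- **`CubeKernelStep` IS NOT A FIBRED STATEMENT.** The crux with `KZ.relations` replaced by
`KZ.fibredRelations ⊔ closure {[r] : dim r ≤ 1}` — all additivity, all parameter-preserving
substitutions in every dimension, all Newton–Leibniz moves over positive-dimensional bases, and every
representation of dimension `≤ 1` granted — FAILS at `d = 1` on `sqRep`. Any proof of the step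
`1 → 2` moves the parameter coordinate. [cite: Ayoub2015, §1] [cite: KontsevichZagier2001, §1.2] -/
theorem cubeKernelStep_false_fibred :
    ¬ ∀ d : ℕ, 1 ≤ d →
        (∀ M : ℕ, M ≤ d → ∀ t : IntegralRep M,
          t.domain = Set.pi Set.univ (fun _ : Fin M => Set.Icc (0:ℝ) 1) →
            ContinuousOn t.integrand t.domain → t.value = 0 →
              of t ∈ fibredRelations ⊔ AddSubgroup.closure lowDim) →
        ∀ t : IntegralRep (d + 1), t.domain = Set.pi Set.univ (fun _ : Fin (d + 1) => Set.Icc (0:ℝ) 1) →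
          ContinuousOn t.integrand t.domain → t.value = 0 →
            of t ∈ fibredRelations ⊔ AddSubgroup.closure lowDim := fun h =>
  sqRep_not_mem_fibred
    (h 1 le_rfl (fun _ hM t _ _ _ => of_mem_fibred_sup_of_le_one hM t) sqRep sqRep_domain
      sqRep_continuousOn value_sqRep)

/-- The rule-(2)-free enlarged sub-calculus of `StepRule2.lean` is contained in the fibred one (a
Newton–Leibniz move over the point is a difference of two low-dimensional generators), so
`cubeKernelStep_false_fibred` implies `cubeKernelStep_false_without_changeOfVariables`. [folklore] -/
theorem rulesOneThreeLow_le_fibred : rulesOneThreeLow ≤ fibredRelations ⊔ AddSubgroup.closure lowDim := by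
  refine (AddSubgroup.closure_le _).mpr ?_
  rintro c (((hc | hc) | hc) | hc)
  · exact AddSubgroup.mem_sup_left (mem_fibredRelations_of_mem_domainAddRel hc)
  · exact AddSubgroup.mem_sup_left (mem_fibredRelations_of_mem_integrandAddRel hc)
  · obtain ⟨n, r, r', a, b, F, hF, ha, hb, hab, hdom, hcont, hderiv, hr', rfl⟩ := hc
    cases n with
    | zero =>
      exact AddSubgroup.sub_mem _ (of_mem_fibred_sup_of_le_one le_rfl r)
        (of_mem_fibred_sup_of_le_one (Nat.zero_le 1) r')
    | succ n =>
      exact AddSubgroup.mem_sup_left (mem_fibredRelations_of_mem_fibredNewtonLeibnizRel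
        ⟨⟨n + 1, r, r', a, b, F, hF, ha, hb, hab, hdom, hcont, hderiv, hr', rfl⟩, n, r, r', rfl⟩)
  · exact AddSubgroup.mem_sup_right (AddSubgroup.subset_closure hc)

end Summit.KontsevichZagierPeriods.UnfoldedStokes.CubeKernelStepNegative

end
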